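import Mathlib.RingTheory.Nullstellensatz
import Mathlib.Analysis.Complex.Polynomial.Basic
import Mathlib.RingTheory.KrullDimension.Zero
import Literature.NumberTheory.Transcendental.ExpDominantSolvability
import Summits.Schanuel.Schanuel.Theorems.ZilberDefs
import HarnessLib

/-!
# The vacuous rungs of the EAC ladder: `d = 0` (`n ≥ 1`) and `n = 0`

For the ladder `EacOfProjDim n d` (`ZilberDefs.lean`): if the additive projection `π₁(V)` of a
nonempty `V = W ∩ (ℂⁿ × (ℂˣ)ⁿ)`, `W` irreducible, has Zariski dimension `0`, then its vanishing ideal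
— a prime (`isPrime_vanishingIdeal_projAdd`, via density of `V` in `W`) of Krull dimension `0`,
hence maximal — is by the Nullstellensatz the ideal of a point `a ∈ ℂⁿ`, so `x₁ = a₁` on `V`,
contradicting additive freeness: `EacOfProjDim n 0` holds vacuously for `n ≥ 1`
(`eacOfProjDim_zero`; Mantova–Masser 2024 §1: "if this dimension is 0 … the existence of (SZ) is
obvious"). The rungs with `n = 0` are trivial (`eacOfProjDim_zero_left`).
-/

noncomputable section

open MvPolynomial
open Literature.NumberTheory.Transcendental

set_option linter.dupNamespace false

namespace Summit.Schanuel.Schanuel.Theorems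

/-- Membership in the vanishing ideal of the additive projection `π₁(V)` of `V = W ∩ (ℂⁿ × (ℂˣ)ⁿ)`
(`W` irreducible, `V ≠ ∅`): `p(x) ∈ I(π₁ V)` iff `p(x)`, viewed in `ℂ[x, y]`, lies in `I(W)` — since
`V` is Zariski dense in `W` (`p(x) · ∏ yᵢ ∈ I(W)` with `∏ yᵢ ∉ I(W)` prime). [folklore] -/
theorem mem_vanishingIdeal_projAdd_iff {n : ℕ} {W : Set (Fin n ⊕ Fin n → ℂ)}
    (hW : IsIrreducibleClosed ℂ W) (hne : (W ∩ torusLocus ℂ n).Nonempty)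
    (p : MvPolynomial (Fin n) ℂ) :
    p ∈ vanishingIdeal ℂ (projAdd '' (W ∩ torusLocus ℂ n)) ↔
      rename Sum.inl p ∈ vanishingIdeal ℂ W := by
  classical
  constructor
  · intro hp
    have hYprod : (∏ i, X (Sum.inr i) : MvPolynomial (Fin n ⊕ Fin n) ℂ) ∉ vanishingIdeal ℂ W := by
      obtain ⟨z, hzW, hzT⟩ := hne
      intro h
      have h1 := (mem_vanishingIdeal_iff.mp h) z hzW
      rw [map_prod] at h1
      simp only [aeval_X] at h1
      exact Finset.prod_ne_zero_iff.mpr (fun i _ => hzT i) h1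
    have hprod : rename Sum.inl p * ∏ i, X (Sum.inr i) ∈ vanishingIdeal ℂ W := by
      rw [mem_vanishingIdeal_iff]
      intro z hzW
      rw [map_mul, map_prod]
      by_cases hzT : z ∈ torusLocus ℂ n
      · have h1 := (mem_vanishingIdeal_iff.mp hp) (projAdd z) ⟨z, ⟨hzW, hzT⟩, rfl⟩
        rw [aeval_rename]
        rw [show (aeval (projAdd z)) p = aeval (z ∘ Sum.inl) p from rfl] at h1
        rw [h1, zero_mul]
      · simp only [mem_torusLocus_iff, not_forall, not_not] at hzT
        obtain ⟨i, hi⟩ := hzT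
        rw [Finset.prod_eq_zero (Finset.mem_univ i) (by rw [aeval_X]; exact hi), mul_zero]
    exact (hW.2.mem_or_mem hprod).resolve_right hYprod
  · intro hp
    rw [mem_vanishingIdeal_iff]
    rintro _ ⟨z, ⟨hzW, -⟩, rfl⟩
    have h1 := (mem_vanishingIdeal_iff.mp hp) z hzW
    rwa [aeval_rename] at h1

/-- The vanishing ideal of the additive projection of `V = W ∩ (ℂⁿ × (ℂˣ)ⁿ)` (`W` irreducible,
`V ≠ ∅`) is prime. [folklore] -/
theorem isPrime_vanishingIdeal_projAdd {n : ℕ} {W : Set (Fin n ⊕ Fin n → ℂ)}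
    (hW : IsIrreducibleClosed ℂ W) (hne : (W ∩ torusLocus ℂ n).Nonempty) :
    (vanishingIdeal ℂ (projAdd '' (W ∩ torusLocus ℂ n))).IsPrime := by
  refine Ideal.isPrime_iff.mpr ⟨?_, fun {p q} hpq => ?_⟩
  · intro htop
    have h1 : (1 : MvPolynomial (Fin n) ℂ) ∈ vanishingIdeal ℂ (projAdd '' (W ∩ torusLocus ℂ n)) :=
      htop ▸ Submodule.mem_top
    obtain ⟨z, hz⟩ := hne
    have := (mem_vanishingIdeal_iff.mp h1) (projAdd z) ⟨z, hz, rfl⟩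
    simp at this
  · rw [mem_vanishingIdeal_projAdd_iff hW hne, map_mul] at hpq
    rcases hW.2.mem_or_mem hpq with h | h
    · exact Or.inl ((mem_vanishingIdeal_projAdd_iff hW hne p).mpr h)
    · exact Or.inr ((mem_vanishingIdeal_projAdd_iff hW hne q).mpr h)

/-- **The rungs `d = 0` are vacuous** (`n ≥ 1`): if the additive projection of a nonempty
`V = W ∩ (ℂⁿ × (ℂˣ)ⁿ)` (`W` irreducible) has Zariski dimension `0`, its vanishing ideal is a prime of
dimension `0`, hence maximal, hence (Nullstellensatz) the ideal of a point `a`: then `x₁ = a₁` on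
`V`, contradicting additive freeness. So `EacOfProjDim n 0` holds trivially. [folklore] -/
theorem eacOfProjDim_zero {n : ℕ} (hn : 1 ≤ n) : EacOfProjDim n 0 := by
  classical
  intro W hW hne _ hadd _ _ hproj
  exfalso
  set I := vanishingIdeal ℂ (projAdd '' (W ∩ torusLocus ℂ n)) with hI
  haveI hIp : I.IsPrime := isPrime_vanishingIdeal_projAdd hW hne
  haveI : IsDomain (MvPolynomial (Fin n) ℂ ⧸ I) := Ideal.Quotient.isDomain I
  have h0 : ringKrullDim (MvPolynomial (Fin n) ℂ ⧸ I) = 0 := hproj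
  haveI : Ring.KrullDimLE 0 (MvPolynomial (Fin n) ℂ ⧸ I) :=
    ringKrullDimZero_iff_ringKrullDim_eq_zero.mpr h0
  have hfield : IsField (MvPolynomial (Fin n) ℂ ⧸ I) := Ring.KrullDimLE.isField_of_isDomain
  have hmax : I.IsMaximal := Ideal.Quotient.maximal_of_isField I hfield
  obtain ⟨a, ha⟩ := (MvPolynomial.isMaximal_iff_eq_vanishingIdeal_singleton (K := ℂ)).mp hmax
  set i₀ : Fin n := ⟨0, hn⟩ with hi₀
  refine hadd (Pi.single i₀ 1) (fun h => by simpa using congr_fun h i₀) ⟨a i₀, fun z hz => ?_⟩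
  have hmem : (X i₀ - C (a i₀) : MvPolynomial (Fin n) ℂ) ∈ I := by
    rw [ha, mem_vanishingIdeal_iff]
    intro x hx
    rw [Set.mem_singleton_iff.mp hx]
    simp
  have h1 := (mem_vanishingIdeal_iff.mp hmem) (projAdd z) ⟨z, hz, rfl⟩
  rw [map_sub, aeval_X, aeval_C, projAdd_apply, sub_eq_zero] at h1
  have h2 : z (Sum.inl i₀) = a i₀ := h1
  simp only [Pi.single_apply, Int.cast_ite, Int.cast_one, Int.cast_zero, ite_mul, one_mul,
    zero_mul, Finset.sum_ite_eq', Finset.mem_univ, if_true]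
  exact h2

/-- **The rungs `n = 0` are trivial**: the unique point of `ℂ⁰ × ℂ⁰` lies on the graph of `exp`.
[folklore] -/
theorem eacOfProjDim_zero_left (d : WithBot ℕ∞) : EacOfProjDim 0 d := by
  intro W _ hne _ _ _ _ _
  obtain ⟨z, hz, -⟩ := hne
  exact ⟨z, hz, fun i => i.elim0⟩

end Summit.Schanuel.Schanuel.Theorems
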